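import Summits.ABC.IUTFork.Cor312RegimeVerbatimPrVolExactCriterion
import HarnessLib

/-!
# [IUTchIII] Cor. 3.12 — the regime decomposition at the print-normalised sharp setting of record, IV: GENERAL bad
# primes — `−|log(Θ)|(t_q, t) − −|log(Θ)|(𝟙)` is supported on the primes under `S`, and the criterion there

PROOF-ONLY support piece of the abc-iut cell (Cor. 3.12 cone, D-0067; seat abc-iut-w4-d107, gen 5; part 14 of the
`Cor312NegLogThetaUpperPrVol*` / `Cor312RegimeVerbatimPrVol*` chain, sequel of parts 11–12; independent of part 13). TAKES NO SIDE on
[IUTchIII] Cor. 3.12; theorems only, 0 `def`s, no new `Prop` fact, no instance.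

Parts 11–12 assumed that the places of `S` lie over ODD primes UNRAMIFIED in `F` (where abc-iut-c312-5's exact local
value is available). At the `K`-level pilot datum of a collection of initial Θ-data (`pilotDataOfK`, abc-iut-c312-8 /
C-cert) the bad primes may ramify in `K`. THIS FILE drops every hypothesis on the bad primes and keeps what locality
alone gives (part 11 `thetaLocal_settingPrVolSharp_inr_eq_of_norm_eq_at`):

* `negLogTheta_settingPrVolSharp_eq_trivial_add_sum_sub` — for ANY finite set `U` of primes containing the primes under
  `S`, any Θ-ideles `t` (non-zero, units off `S`) and any `q`-ideles:
  `−|log(Θ)|(t_q, t) = −|log(Θ)|(𝟙) + PN_i Σ_{p∈U} (−|log(Θ)|_{i+1,p}(t) − −|log(Θ)|_{i+1,p}(𝟙))` — the difference of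
  the Θ-volume and the trivial configuration's Θ-volume is SUPPORTED ON THE PRIMES UNDER `S` (off `U` the Θ-boxes of
  `t` are unit boxes, same local term as `𝟙`; at `∞` both vanish);
* `statement_settingPrVolSharp_iff_general` — hence, with `q`-exponents `m_q` over `U`,
  `Statement(t_q, t) ⟺ ↑(Qside(m_q) − PN_i Σ_{p∈U} (−|log(Θ)|_{i+1,p}(t) − −|log(Θ)|_{i+1,p}(𝟙))) ≤ −|log(Θ)|(𝟙)`:
  at ANY genuine sharp setting the typed Corollary 3.12 is decided by the local Θ-terms AT THE BAD PRIMES ONLY against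
  the one number `−|log(Θ)|(𝟙)`; the summand at an odd unramified `p ∈ U` is c312-5's exact value
  (`thetaLocal_untopD_sub_trivial_eq_exact`), at a ramified or dyadic bad prime it is the object of abc-iut-c312-5's
  hull-gain files (region ≤ hull, strict at ramified packets; `0 ≤ −|log(Θ)|(𝟙)` always, `> 0` at a ramified base
  field — part 13).
HONEST SCOPE as in parts 7–13: (Ind2) as typed at the real setting (`Real.ismDH`); sharp (Ind3) reading; trivial
archimedean container; free ideles; nothing here asserts or denies [IUTchIII] Cor. 3.12 for initial Θ-data.
typed ≠ proved; instantiated ≠ endorsed. [claim: Mochizuki2012, status: disputed]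
[cite: DupuyHilado2025, §3.6, §3.7, §3.9, §4.7, §4.9] [cite: Mochizuki2012, IUTchIV Thm. 1.10 Step (v) p. 27]
-/

noncomputable section

open Set Function NumberField IsDedekindDomain
open scoped Pointwise

namespace Summit.ABC

namespace IUTFork

namespace Thm311

namespace Real

open Cor312 Cor312.Setting Cor312Vol Literature.IUT.LogThetaLattice Literature.IUT.LogVolume

variable {F : Type} [Field F] [NumberField F] (X : PilotData F) {logv : PadicLogs F} (hlog : LogvAnalytic logv)

section General

variable (M : Type) [Field M] [NumberField M]
  (archPk : ∀ (j : (thetaIndex X).Label) (vQ : (thetaIndex X).VQ), Set ((logShellsDH X logv).Packet j vQ))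
  (archSub : ∀ (j : (thetaIndex X).Label) (v : (thetaIndex X).V),
    Set ((logShellsDH X logv).Packet j ((thetaIndex X).over v)))
  (Ψ : ℤ → ∀ v : (thetaIndex X).V, v ∈ (thetaIndex X).Vbad → Set ((logShellsDH X logv).StarPacket v))
  (act : ℤ → ∀ v : (thetaIndex X).V, v ∈ (thetaIndex X).Vbad →
    (logShellsDH X logv).StarPacket v → Module.End ℚ ((logShellsDH X logv).StarPacket v))
  (Mmod : ℤ → ∀ j : (thetaIndex X).LabelStar, Set ((logShellsDH X logv).GlobalPacket j.1))
  (region : ℤ → ∀ j : (thetaIndex X).LabelStar, FinDivisor M → ∀ vQ : (thetaIndex X).VQ,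
    Set ((logShellsDH X logv).Packet j.1 vQ))
  (n : ℤ) {HT : Type} {LogLink : HT → HT → Type} {IsFull : ∀ {s t : HT}, LogLink s t → Prop}
  (lat : LGPGaussianLogThetaLattice LogLink IsFull)
  {Frd : Type} {IsoF : Frd → Frd → Type} {Ob : Frd → Type} {realify : Frd → Frd} {Strip : Type}
  {IsoS : Strip → Strip → Type} {Mv : ∀ v : (thetaIndex X).V, v ∈ (thetaIndex X).Vbad → Type}
  [∀ v h, Monoid (Mv v h)]
  (sig : GlobalLGPFrobenioidSignature (thetaIndex X).lstar (thetaIndex X).V (· ∈ (thetaIndex X).Vbad)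
    Frd IsoF Ob realify Strip IsoS Mv)
  (split : SplittingMonoids Mv) {ObΔ : Type} {N : ∀ v : (thetaIndex X).V, v ∈ (thetaIndex X).Vbad → Type}
  [∀ v h, Monoid (N v h)] (qData : QPilotData ObΔ N)
  (t : ∀ (pp : Nat.Primes) (_ : Fin X.lstar) (x : (thetaIndex X).Fibre (.inr pp)),
    haveI : Fact (pp : ℕ).Prime := ⟨pp.2⟩; kOf X pp.1 x)
  (tq : ∀ (pp : Nat.Primes) (x : (thetaIndex X).Fibre (.inr pp)), haveI : Fact (pp : ℕ).Prime := ⟨pp.2⟩; kOf X pp.1 x)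

/-- **THE GENERAL DECOMPOSITION: `−|log(Θ)|(t_q, t) − −|log(Θ)|(𝟙)` is supported on the primes under `S`.** For ANY
finite set `U` of primes containing every prime under `S`, any Θ-ideles `t` (non-zero, units off `S`) and any
`q`-ideles (non-zero, units off `S`):
`−|log(Θ)|(t_q, t) = −|log(Θ)|(𝟙) + PN_i Σ_{p∈U} (−|log(Θ)|_{i+1,p}(t_q, t) − −|log(Θ)|_{i+1,p}(𝟙))` — no parity or
ramification hypothesis: off `U` the Θ-boxes of `t` are unit boxes and the local terms of `t` and `𝟙` COINCIDE (part 11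
locality), at `∞` both vanish. [cite: DupuyHilado2025, §3.6, §3.9, §4.9] [claim: Mochizuki2012, status: disputed] -/
theorem negLogTheta_settingPrVolSharp_eq_trivial_add_sum_sub (ht0 : ∀ pp i x, t pp i x ≠ 0)
    (ht1 : ∀ (pp : Nat.Primes) (i : Fin X.lstar) (x : (thetaIndex X).Fibre (.inr pp)),
      haveI : Fact (pp : ℕ).Prime := ⟨pp.2⟩; placeOf X pp.1 x ∉ X.S → ‖t pp i x‖ = 1)
    (htq0 : ∀ pp x, tq pp x ≠ 0)
    (htq1 : ∀ (pp : Nat.Primes) (x : (thetaIndex X).Fibre (.inr pp)),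
      haveI : Fact (pp : ℕ).Prime := ⟨pp.2⟩; placeOf X pp.1 x ∉ X.S → ‖tq pp x‖ = 1)
    (U : Finset Nat.Primes)
    (hU : ∀ (pp : Nat.Primes) (x : (thetaIndex X).Fibre (.inr pp)),
      haveI : Fact (pp : ℕ).Prime := ⟨pp.2⟩; placeOf X pp.1 x ∈ X.S → pp ∈ U) :
    (settingPrVolSharp X hlog M archPk archSub Ψ act Mmod region n lat sig split qData tq t htq0 htq1).negLogTheta =
      (settingPrVolSharp X hlog M archPk archSub Ψ act Mmod region n lat sig split qData (fun _ _ => 1) (fun _ _ _ => 1)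
          (fun _ _ => one_ne_zero) (fun _ _ _ => norm_one)).negLogTheta +
        ((processionNormalized (fun i : Fin (thetaIndex X).lstar => ∑ pp ∈ U,
          (((settingPrVolSharp X hlog M archPk archSub Ψ act Mmod region n lat sig split qData tq t htq0 htq1).thetaLocal
              (Setting.labelSucc i) (.inr pp)).untopD 0 -
            ((settingPrVolSharp X hlog M archPk archSub Ψ act Mmod region n lat sig split qData (fun _ _ => 1)
              (fun _ _ _ => 1) (fun _ _ => one_ne_zero) (fun _ _ _ => norm_one)).thetaLocal (Setting.labelSucc i)
                (.inr pp)).untopD 0)) : ℝ) : WithTop ℝ) := by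
  have hfinΘ := thetaFinite_settingPrVolSharp X hlog M archPk archSub Ψ act Mmod region n lat sig split qData t tq ht0 ht1
    htq0 htq1
  have hfinΘ₁ := thetaFinite_settingPrVolSharp X hlog M archPk archSub Ψ act Mmod region n lat sig split qData
    (fun _ _ _ => 1) (fun _ _ => 1) (fun _ _ _ => one_ne_zero) (fun _ _ _ _ => norm_one) (fun _ _ => one_ne_zero)
    (fun _ _ _ => norm_one)
  have H := bridgeHyps_settingPrVolSharp_of_ideles X hlog M archPk archSub Ψ act Mmod region n lat sig split qData t tq ht0
    ht1 htq0 htq1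
  have H₁ := bridgeHyps_settingPrVolSharp_of_ideles X hlog M archPk archSub Ψ act Mmod region n lat sig split qData
    (fun _ _ _ => 1) (fun _ _ => 1) (fun _ _ _ => one_ne_zero) (fun _ _ _ _ => norm_one) (fun _ _ => one_ne_zero)
    (fun _ _ _ => norm_one)
  have hunit : ∀ (pp : Nat.Primes), pp ∉ U → ∀ (i : Fin (thetaIndex X).lstar) (x : (thetaIndex X).Fibre (.inr pp)),
      ‖t pp i x‖ = 1 := fun pp hpp i x => ht1 pp i x fun hS => hpp (hU pp x hS)
  unfold Setting.negLogTheta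
  rw [if_pos hfinΘ, if_pos hfinΘ₁, ← WithTop.coe_add, WithTop.coe_inj]
  have hadd : ∀ f g : Fin (thetaIndex X).lstar → ℝ,
      processionNormalized f + processionNormalized g = processionNormalized (fun i => f i + g i) := fun f g => by
    unfold processionNormalized; rw [Finset.sum_add_distrib, add_div]
  rw [hadd]
  refine congrArg processionNormalized (funext fun i => ?_)
  -- abbreviations for the two local-term functions at the label `i+1`
  set ft : (thetaIndex X).VQ → ℝ := fun vQ =>
    ((settingPrVolSharp X hlog M archPk archSub Ψ act Mmod region n lat sig split qData tq t htq0 htq1).thetaLocal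
      (Setting.labelSucc i) vQ).untopD 0 with hft
  set f1 : (thetaIndex X).VQ → ℝ := fun vQ =>
    ((settingPrVolSharp X hlog M archPk archSub Ψ act Mmod region n lat sig split qData (fun _ _ => 1) (fun _ _ _ => 1)
      (fun _ _ => one_ne_zero) (fun _ _ _ => norm_one)).thetaLocal (Setting.labelSucc i) vQ).untopD 0 with hf1
  -- the correction: the difference on `U`, `0` elsewhere
  let g : (thetaIndex X).VQ → ℝ := fun vQ =>
    match vQ with
    | .inl _ => 0
    | .inr pp => if pp ∈ U then ft (.inr pp) - f1 (.inr pp) else 0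
  have hg_supp : (Function.support g) ⊆
      ((U.map ⟨(Sum.inr : Nat.Primes → (thetaIndex X).VQ), fun _ _ h => Sum.inr_injective h⟩ :
        Finset (thetaIndex X).VQ) : Set (thetaIndex X).VQ) := by
    intro vQ hvQ
    rw [Function.mem_support] at hvQ
    rcases vQ with u | pp
    · exact absurd rfl hvQ
    · rw [Finset.coe_map, Set.mem_image]
      by_cases hpp : pp ∈ U
      · exact ⟨pp, Finset.mem_coe.mpr hpp, rfl⟩
      · exact absurd (by show g (.inr pp) = 0; exact if_neg hpp) hvQ
  have hg_fin : (Function.support g).Finite := (Finset.finite_toSet _).subset hg_supp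
  have hsum : ∑ᶠ vQ, g vQ = ∑ pp ∈ U, (ft (.inr pp) - f1 (.inr pp)) := by
    rw [finsum_eq_sum_of_support_subset g hg_supp, Finset.sum_map]
    exact Finset.sum_congr rfl fun pp hpp => if_pos hpp
  show ∑ᶠ vQ, ft vQ = ∑ᶠ vQ, f1 vQ + ∑ pp ∈ U, (ft (.inr pp) - f1 (.inr pp))
  rw [← hsum, ← finsum_add_distrib (hfinΘ₁.2 i) hg_fin]
  refine finsum_congr fun vQ => ?_
  rcases vQ with u | pp
  · -- at `∞`: both local terms vanish
    show ft (.inl u) = f1 (.inl u) + (0 : ℝ)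
    rw [add_zero, hft, hf1]
    exact (thetaLocal_settingPrVol_untopD_inl X hlog M archPk archSub Ψ act Mmod region n lat sig split qData _ _ _ _ u i
      H).trans (thetaLocal_settingPrVol_untopD_inl X hlog M archPk archSub Ψ act Mmod region n lat sig split qData _ _ _ _ u
        i H₁).symm
  · by_cases hpp : pp ∈ U
    · -- on `U`: tautological
      show ft (.inr pp) = f1 (.inr pp) + g (.inr pp)
      rw [show g (.inr pp) = ft (.inr pp) - f1 (.inr pp) from if_pos hpp]
      ring
    · -- off `U`: unit boxes on both sides, the same local term (part 11)
      show ft (.inr pp) = f1 (.inr pp) + g (.inr pp)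
      rw [show g (.inr pp) = 0 from if_neg hpp, add_zero, hft, hf1]
      exact congrArg (WithTop.untopD 0) (thetaLocal_settingPrVolSharp_inr_eq_of_norm_eq_at X hlog t (fun _ _ _ => 1) M
        archPk archSub Ψ act Mmod region n lat sig split qData tq (fun _ _ => 1) ht0 htq0 htq1 (fun _ _ => one_ne_zero)
        (fun _ _ _ => norm_one) pp (fun i' x => by rw [hunit pp hpp i' x, norm_one]) (Setting.labelSucc i))

/-- **The summand at an odd unramified bad prime is abc-iut-c312-5's exact value**: for `p ∈ U` odd with
`p ∤ disc(F)` and Θ-exponents `‖t_{Θ,i+1,v}‖ = ‖p^{m(v)}‖` over `p`,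
`−|log(Θ)|_{i+1,p}(t) − −|log(Θ)|_{i+1,p}(𝟙) = Σ_{v⃗} Pr(v⃗)·(−min_a m(v⃗ a)·log p)` (parts 7/11). [cite: DupuyHilado2025, §3.6, §3.9, §4.7] -/
theorem thetaLocal_untopD_sub_trivial_eq_exact (ht0 : ∀ pp i x, t pp i x ≠ 0) (htq0 : ∀ pp x, tq pp x ≠ 0)
    (htq1 : ∀ (pp : Nat.Primes) (x : (thetaIndex X).Fibre (.inr pp)),
      haveI : Fact (pp : ℕ).Prime := ⟨pp.2⟩; placeOf X pp.1 x ∉ X.S → ‖tq pp x‖ = 1)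
    (i : Fin (thetaIndex X).lstar) (pp : Nat.Primes) (hp2 : 2 < (pp : ℕ))
    (hdisc : ¬ ((pp : ℕ) : ℤ) ∣ NumberField.discr F) (m : (thetaIndex X).Fibre (.inr pp) → ℤ)
    (hm : haveI : Fact (pp : ℕ).Prime := ⟨pp.2⟩; ∀ x, ‖t pp i x‖ = ‖((pp : ℕ) : ℚ_[pp]) ^ m x‖) :
    haveI : Fact (pp : ℕ).Prime := ⟨pp.2⟩
    ((settingPrVolSharp X hlog M archPk archSub Ψ act Mmod region n lat sig split qData tq t htq0 htq1).thetaLocal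
          (Setting.labelSucc i) (.inr pp)).untopD 0 -
        ((settingPrVolSharp X hlog M archPk archSub Ψ act Mmod region n lat sig split qData (fun _ _ => 1)
          (fun _ _ _ => 1) (fun _ _ => one_ne_zero) (fun _ _ _ => norm_one)).thetaLocal (Setting.labelSucc i)
            (.inr pp)).untopD 0 =
      ∑ e : (presAt X hlog pp).toLocalPieces.E (Setting.labelSucc i),
        weightPr X pp.1 (Setting.labelSucc i) e *
          (-(Finset.univ.inf' Finset.univ_nonempty (fun a => m (e a)) * Real.log (pp : ℕ))) := by
  haveI : Fact (pp : ℕ).Prime := ⟨pp.2⟩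
  rw [thetaLocal_untopD_settingPrVolSharp_eq_of_zpow X hlog M archPk archSub Ψ act Mmod region n lat sig split qData t tq
    ht0 htq0 htq1 i pp hp2 hdisc m hm,
    thetaLocal_untopD_settingPrVolSharp_trivial_eq_zero X hlog M archPk archSub Ψ act Mmod region n lat sig split qData i
      pp hp2 hdisc, sub_zero]

/-- **THE GENERAL CRITERION.** For ANY finite set `U` of primes containing the primes under `S`, pilot ideles (non-zero,
units off `S`) and `q`-exponents `‖t_{q,v}‖ = ‖p^{m_q(v)}‖` over `U`:
`Statement(t_q, t) ⟺ ↑(Qside(m_q) − PN_i Σ_{p∈U} (−|log(Θ)|_{i+1,p}(t) − −|log(Θ)|_{i+1,p}(𝟙))) ≤ −|log(Θ)|(𝟙)` —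
at every genuine sharp setting the typed [IUTchIII] Cor. 3.12 is decided by the local Θ-terms AT THE BAD PRIMES against
the single number `−|log(Θ)|(𝟙) ≥ 0`; no side taken. [claim: Mochizuki2012, status: disputed]
[cite: DupuyHilado2025, §3.6, §3.9, §4.7, §4.9] -/
theorem statement_settingPrVolSharp_iff_general (ht0 : ∀ pp i x, t pp i x ≠ 0)
    (ht1 : ∀ (pp : Nat.Primes) (i : Fin X.lstar) (x : (thetaIndex X).Fibre (.inr pp)),
      haveI : Fact (pp : ℕ).Prime := ⟨pp.2⟩; placeOf X pp.1 x ∉ X.S → ‖t pp i x‖ = 1)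
    (htq0 : ∀ pp x, tq pp x ≠ 0)
    (htq1 : ∀ (pp : Nat.Primes) (x : (thetaIndex X).Fibre (.inr pp)),
      haveI : Fact (pp : ℕ).Prime := ⟨pp.2⟩; placeOf X pp.1 x ∉ X.S → ‖tq pp x‖ = 1)
    (U : Finset Nat.Primes)
    (hU : ∀ (pp : Nat.Primes) (x : (thetaIndex X).Fibre (.inr pp)),
      haveI : Fact (pp : ℕ).Prime := ⟨pp.2⟩; placeOf X pp.1 x ∈ X.S → pp ∈ U)
    (mq : ∀ pp : Nat.Primes, (thetaIndex X).Fibre (.inr pp) → ℤ)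
    (hmq : ∀ (pp : Nat.Primes), pp ∈ U → ∀ (x : (thetaIndex X).Fibre (.inr pp)),
      haveI : Fact (pp : ℕ).Prime := ⟨pp.2⟩; ‖tq pp x‖ = ‖((pp : ℕ) : ℚ_[pp]) ^ mq pp x‖) :
    (settingPrVolSharp X hlog M archPk archSub Ψ act Mmod region n lat sig split qData tq t htq0 htq1).Statement ↔
      ((processionNormalized (fun i : Fin (thetaIndex X).lstar => ∑ pp ∈ U,
            (haveI : Fact (pp : ℕ).Prime := ⟨pp.2⟩;
              ∑ e : (presAt X hlog pp).toLocalPieces.E (Setting.labelSucc i),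
                weightPr X pp.1 (Setting.labelSucc i) e * (-(mq pp (e (Fin.last _))) * Real.log (pp : ℕ)))) -
          processionNormalized (fun i : Fin (thetaIndex X).lstar => ∑ pp ∈ U,
            (((settingPrVolSharp X hlog M archPk archSub Ψ act Mmod region n lat sig split qData tq t htq0 htq1).thetaLocal
                (Setting.labelSucc i) (.inr pp)).untopD 0 -
              ((settingPrVolSharp X hlog M archPk archSub Ψ act Mmod region n lat sig split qData (fun _ _ => 1)
                (fun _ _ _ => 1) (fun _ _ => one_ne_zero) (fun _ _ _ => norm_one)).thetaLocal (Setting.labelSucc i)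
                  (.inr pp)).untopD 0)) : ℝ) : WithTop ℝ) ≤
        (settingPrVolSharp X hlog M archPk archSub Ψ act Mmod region n lat sig split qData (fun _ _ => 1)
          (fun _ _ _ => 1) (fun _ _ => one_ne_zero) (fun _ _ _ => norm_one)).negLogTheta := by
  have hdec := negLogTheta_settingPrVolSharp_eq_trivial_add_sum_sub X hlog M archPk archSub Ψ act Mmod region n lat sig
    split qData t tq ht0 ht1 htq0 htq1 U hU
  have hq := negLogQ_settingPrVolSharp_eq_exact X hlog M archPk archSub Ψ act Mmod region n lat sig split qData t tq htq0
    htq1 U hU mq hmq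
  obtain ⟨K₀, hK₀⟩ := WithTop.ne_top_iff_exists.mp (negLogTheta_settingPrVolSharp_trivial_ne_top X hlog M archPk archSub
    Ψ act Mmod region n lat sig split qData)
  unfold Setting.Statement
  rw [hdec, hq, ← hK₀, ← WithTop.coe_add, WithTop.coe_le_coe, WithTop.coe_le_coe]
  constructor
  · rintro ⟨-, h⟩
    linarith
  · intro h
    exact ⟨WithTop.coe_ne_top, by linarith⟩

end General

end Real

end Thm311

end IUTFork

end Summit.ABC

end
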